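import Mathlib
import Summits.ResolutionOfSingularities.ResolutionOfSingularities.Theorems.WeightedInvariantLocalWeightedDropTOT2CurveBranchWitnessInsepTools
import Summits.ResolutionOfSingularities.ResolutionOfSingularities.Theorems.WeightedInvariantLocalWeightedDropNCPolyBridgeRepresents

/-!
# `LocalWeightedDrop`, TOT2-LINE regime (P), piece (B1b-insep): the `h`-INDEPENDENT BRANCH WITNESS for a purely inseparable label

Crux item stmt-ResolutionOfSingularities-8899 `WeightedInvariant.LocalWeightedDrop` (route `ResolutionOfSingularities/WeightedInvariant`), ENGINE
skeleton v33 (35b29332b4d99231), registered stub `stub_regimePresented`; TOT2-LINE v1.3 §3 (P3)/(B1) (`L/res-L1-w43-lead-1/g5/TOT2-LINE-v1.3.md`),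
NAMING res-L1-w43-lead-1 2026-08-27T16:23:53Z.  [OURS · L1 W4.3 · chain w43 · seat res-L1-w43-stub-1 gen 6; def-free; complements res-L1-w43-lead-1's
(B1b-mixed) `…TOT2CurveBranchWitness` and feeds the counting half (B1a) `TOT2Curve.finite_curveRoots` (p547036); elementary power-series
algebra in characteristic `p` (Frobenius through `MvPowerSeries.expand`); nothing here is a statement of any manuscript; AI-produced, gate-checked,
weaker than expert review.]

THE STATEMENT (`exists_branchWitness_insep`).  `k` a perfect field of characteristic `p`, `d = p^n ≥ p`, `A : Fin d → k⟦u₁,u₂⟧` a label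
concentrated in slot `0` (`A_i = 0` for `i ≠ 0`) with SQUAREFREE monic germ `y^d + A₀`.  Then there is ONE series `D ≠ 0` such that for every
`u₂`-free `h = h(u₁)` for which some re-centring `y ↦ y + ψ`, `ψ(0) = 0`, of the sheared label `A(u₁, u₂ + u₁h)` is `V(y,u₂)`-permissible,
`D(u₁, u₁h) = 0` (`subst ![X 0, 0] (shear h D) = 0`).  With (B1a) the set of such graph branches `u₂ = u₁h(u₁)` is finite.

THE PROOF (derivative-free; tools in `…TOT2CurveBranchWitnessInsepTools`).  Slot `0` of the re-centred sheared label is `ψ^d + A₀(u₁, u₂ + u₁h)` (`shift_shearT_zero`), so permissibility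
kills all its coefficients of `u₂`-degree `< d` (`coeff_slot_zero_eq_zero`); `ψ^d = ψ^{p^n}` only has exponents in `p^n·ℕ²`
(`coeff_pow_prime_pow_eq_zero`, Frobenius = `map (iterateFrobenius) ∘ expand`).
* (a) some monomial of `A₀` has `p ∤ e₂`: split `A₀ = Σ_{t<p} u₂^t C_t` by `e₂ mod p` (`eq_sum_X_pow_mul_modPart`); `C_t(u₁, u₂ + u₁h)` has no
  monomial with `0 < e₂ < p` (`coeff_shear_eq_zero_of_dvd_one`: `(u₂ + u₁h)^{pb} = ((u₂+u₁h)^b)^p`), so modulo `u₂^p` the slot is the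
  `u₂`-polynomial `E' + Σ_t (u₂ + u₁h)^t E_t` of degree `< p` (`E_t = C_t(u₁,u₁h)`, `E' = (ψ^d)(u₁,0)`), which must then vanish identically; it is
  the shear of `E' + Σ_t u₂^t E_t`, the shear is injective, so `E_t = 0` for `t ≥ 1` (`killTwo_shear_modPart_eq_zero`); `D := C_t`, `t ≥ 1`.
* (b) all `e₂ ≡ 0` but some `e₁ ≢ 0 (mod p)`: the `u₂`-free row gives `A₀(u₁,u₁h) = −(ψ^d)(u₁,0) ∈ k⟦u₁^p⟧`; split `A₀ = Σ_{s<p} u₁^s D_s` by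
  `e₁ mod p`; every `D_s` has all exponents divisible by `p`, so `D_s(u₁,u₁h) ∈ k⟦u₁^p⟧` (`coeff_shear_eq_zero_of_dvd_both`), and uniqueness
  of the decomposition by `e₁ mod p` (`eq_zero_of_sum_X_zero_pow_mul`) gives `D_s(u₁,u₁h) = 0` for `s ≥ 1`; `D := D_s`, `s ≥ 1`.
* (c) all exponents divisible by `p` (and `A₀(0) = 0`, else no `h` qualifies): `A₀ = G^p` (`k` perfect), `y^d + A₀ = (y^{d/p} + G)^p` is not
  squarefree (`not_squarefree_monicGerm_of_dvd`).
With (B1a) `TOT2Curve.finite_curveRoots` (res-L1-w43-lead-1, p547036): `finite_graphBranches_insep` — finitely many graph branches.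
-/

set_option linter.dupNamespace false -- mandated namespace of this single-conjunct summit

noncomputable section

namespace Summit.ResolutionOfSingularities.ResolutionOfSingularities.Theorems

namespace TOT2Curve

open MvPowerSeries PolyDescent MonicDescent WildMonic Literature.AlgebraicGeometry.Resolution

variable {k : Type} [Field k]

/-! ## Case (a): `C_t(u₁,u₁h) = 0` for `t ≥ 1` -/

/-- CASE (a) CORE.  `d = p^n ≥ p`, `h` `u₂`-free, `C_t` (`t < p`) with `p ∣` every `u₂`-exponent, and all coefficients of
`ψ^d + (Σ_{t<p} u₂^t C_t)(u₁, u₂ + u₁h)` of `u₂`-degree `< d` vanish.  Then `C_t(u₁, u₁h) = 0` for `1 ≤ t < p`. -/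
theorem killTwo_shear_modPart_eq_zero (p : ℕ) [Fact p.Prime] [CharP k p] {n : ℕ} (hn : n ≠ 0) {h ψ : MvPowerSeries (Fin 2) k}
    (hh : ∀ m : Fin 2 →₀ ℕ, m 1 ≠ 0 → coeff m h = 0) (C : ℕ → MvPowerSeries (Fin 2) k)
    (hC : ∀ t (e : Fin 2 →₀ ℕ), coeff e (C t) ≠ 0 → p ∣ e 1)
    (hvan : ∀ m : Fin 2 →₀ ℕ, m 1 < p ^ n → coeff m (ψ ^ p ^ n + shear h (∑ t ∈ Finset.range p, X 1 ^ t * C t)) = 0)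
    {t : ℕ} (ht1 : 1 ≤ t) (htp : t < p) : subst (![X 0, 0] : Fin 2 → MvPowerSeries (Fin 2) k) (shear h (C t)) = 0 := by
  have hp : p.Prime := Fact.out
  have hpq : p ≤ p ^ n := by
    calc p = p ^ 1 := (pow_one p).symm
      _ ≤ p ^ n := Nat.pow_le_pow_right hp.pos (Nat.one_le_iff_ne_zero.mpr hn)
  -- the `u₂`-free rows
  set E : ℕ → MvPowerSeries (Fin 2) k := fun s => subst (![X 0, 0] : Fin 2 → MvPowerSeries (Fin 2) k) (shear h (C s)) with hEdef
  set E' : MvPowerSeries (Fin 2) k := subst (![X 0, 0] : Fin 2 → MvPowerSeries (Fin 2) k) (ψ ^ p ^ n) with hE'def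
  have hEnoY : ∀ s (m : Fin 2 →₀ ℕ), m 1 ≠ 0 → coeff m (E s) = 0 := fun s m hm => coeff_killTwo_of_ne_zero _ hm
  have hE'noY : ∀ m : Fin 2 →₀ ℕ, m 1 ≠ 0 → coeff m E' = 0 := fun m hm => coeff_killTwo_of_ne_zero _ hm
  -- (1) `u₂^p ∣ C_s(u₁,u₂+u₁h) − E_s`
  have hdvd1 : ∀ s, (X 1 : MvPowerSeries (Fin 2) k) ^ p ∣ shear h (C s) - E s := by
    intro s
    rw [X_pow_dvd_iff]
    intro m hm
    rw [map_sub, hEdef, coeff_subst_killTwo]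
    split_ifs with hm1
    · exact sub_self _
    · rw [sub_zero]
      exact coeff_shear_eq_zero_of_dvd_one p h (hC s) hm1 hm
  -- (2) `u₂^p ∣ ψ^d − E'`
  have hdvd2 : (X 1 : MvPowerSeries (Fin 2) k) ^ p ∣ ψ ^ p ^ n - E' := by
    rw [X_pow_dvd_iff]
    intro m hm
    rw [map_sub, hE'def, coeff_subst_killTwo]
    split_ifs with hm1
    · exact sub_self _
    · rw [sub_zero]
      apply coeff_pow_prime_pow_eq_zero p ψ n (i := 1)
      intro hdvd
      exact absurd (Nat.le_of_dvd (Nat.pos_of_ne_zero hm1) hdvd) (not_le.mpr (lt_of_lt_of_le hm hpq))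
  -- (3) `u₂^p ∣` the whole slot
  have hdvd3 : (X 1 : MvPowerSeries (Fin 2) k) ^ p ∣ ψ ^ p ^ n + shear h (∑ s ∈ Finset.range p, X 1 ^ s * C s) := by
    rw [X_pow_dvd_iff]
    intro m hm
    exact hvan m (lt_of_lt_of_le hm hpq)
  -- (4) hence `u₂^p ∣ P := E' + Σ (u₂+u₁h)^s E_s`
  have hshear : shear h (∑ s ∈ Finset.range p, X 1 ^ s * C s) = ∑ s ∈ Finset.range p, (X 1 + X 0 * h) ^ s * shear h (C s) := by
    rw [shear_finset_sum]
    exact Finset.sum_congr rfl fun s _ => shear_X_one_pow_mul h (C s) s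
  have hdvd4 : (X 1 : MvPowerSeries (Fin 2) k) ^ p ∣ E' + ∑ s ∈ Finset.range p, (X 1 + X 0 * h) ^ s * E s := by
    have h1 : E' + ∑ s ∈ Finset.range p, (X 1 + X 0 * h) ^ s * E s =
        (ψ ^ p ^ n + shear h (∑ s ∈ Finset.range p, X 1 ^ s * C s)) - ((ψ ^ p ^ n - E') +
          ∑ s ∈ Finset.range p, (X 1 + X 0 * h) ^ s * (shear h (C s) - E s)) := by
      rw [hshear]
      simp only [mul_sub, Finset.sum_sub_distrib]
      ring
    rw [h1]
    exact dvd_sub hdvd3 (dvd_add hdvd2 (Finset.dvd_sum fun s _ => Dvd.dvd.mul_left (hdvd1 s) _))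
  -- (5) `P` has `u₂`-degree `< p`, so `P = 0`
  have hP : E' + ∑ s ∈ Finset.range p, (X 1 + X 0 * h) ^ s * E s = 0 := by
    ext m
    rw [map_zero]
    by_cases hm : m 1 < p
    · exact (X_pow_dvd_iff.mp hdvd4) m hm
    · push Not at hm
      rw [map_add, hE'noY m (by omega), zero_add, map_sum, Finset.sum_eq_zero]
      intro s hs
      exact coeff_shearX_pow_mul_eq_zero hh (hEnoY s) (lt_of_lt_of_le (Finset.mem_range.mp hs) hm)
  -- (6) `P = shear h (E' + Σ u₂^s E_s)`, the shear is injective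
  have hW : E' + ∑ s ∈ Finset.range p, X 1 ^ s * E s = 0 := by
    apply shear_injective_of_noY hh
    rw [shear_eq h (E' + _), subst_add (hasSubst_of_constantCoeff_zero (constantCoeff_shearFamily h)), ← shear_eq, ← shear_eq,
      shear_eq_self_of_noY h E' hE'noY, shear_finset_sum, ← hP]
    congr 1
    exact Finset.sum_congr rfl fun s _ => by rw [shear_X_one_pow_mul, shear_eq_self_of_noY h (E s) (hEnoY s)]
  -- (7) read off the rows
  exact eq_zero_of_sum_X_one_pow_mul hE'noY hEnoY hW ht1 htp

/-! ## Case (b): `D_s(u₁,u₁h) = 0` for `s ≥ 1` -/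

/-- CASE (b) CORE.  `d = p^n ≥ p`, `h` arbitrary, `D_s` (`s < p`) with `p ∣` EVERY exponent, and all coefficients of
`ψ^d + (Σ_{s<p} u₁^s D_s)(u₁, u₂ + u₁h)` of `u₂`-degree `< d` vanish.  Then `D_s(u₁, u₁h) = 0` for `1 ≤ s < p`. -/
theorem killTwo_shear_modPart_eq_zero' (p : ℕ) [Fact p.Prime] [CharP k p] {n : ℕ} (hn : n ≠ 0) {h ψ : MvPowerSeries (Fin 2) k}
    (D : ℕ → MvPowerSeries (Fin 2) k)
    (hD : ∀ s (e : Fin 2 →₀ ℕ), coeff e (D s) ≠ 0 → p ∣ e 0 ∧ p ∣ e 1)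
    (hvan : ∀ m : Fin 2 →₀ ℕ, m 1 < p ^ n → coeff m (ψ ^ p ^ n + shear h (∑ s ∈ Finset.range p, X 0 ^ s * D s)) = 0)
    {s : ℕ} (hs1 : 1 ≤ s) (hsp : s < p) : subst (![X 0, 0] : Fin 2 → MvPowerSeries (Fin 2) k) (shear h (D s)) = 0 := by
  have hp : p.Prime := Fact.out
  have hd0 : 0 < p ^ n := pow_pos hp.pos n
  set G : ℕ → MvPowerSeries (Fin 2) k := fun s => subst (![X 0, 0] : Fin 2 → MvPowerSeries (Fin 2) k) (shear h (D s)) with hGdef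
  set E' : MvPowerSeries (Fin 2) k := subst (![X 0, 0] : Fin 2 → MvPowerSeries (Fin 2) k) (ψ ^ p ^ n) with hE'def
  -- the `u₂`-free row of the slot: `E' + Σ u₁^s G_s = 0`
  have hrow : ∑ s ∈ Finset.range p, X 0 ^ s * G s = -E' := by
    rw [eq_neg_iff_add_eq_zero, add_comm]
    have h1 : ∑ s ∈ Finset.range p, X 0 ^ s * G s =
        subst (![X 0, 0] : Fin 2 → MvPowerSeries (Fin 2) k) (shear h (∑ s ∈ Finset.range p, X 0 ^ s * D s)) := by
      rw [shear_finset_sum, ← substAlgHom_apply hasSubst_killTwo, map_sum]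
      refine Finset.sum_congr rfl fun s _ => ?_
      rw [shear_X_pow_mul, map_mul, map_pow, substAlgHom_apply, subst_X hasSubst_killTwo, substAlgHom_apply]
      rfl
    rw [h1, hE'def, ← subst_add hasSubst_killTwo]
    ext m
    rw [coeff_subst_killTwo, map_zero]
    split_ifs with hm
    · exact hvan m (by rw [hm]; exact hd0)
    · rfl
  have hE' : ∀ m : Fin 2 →₀ ℕ, ¬ p ∣ m 0 → coeff m (-E') = 0 := by
    intro m hm
    rw [map_neg, hE'def, coeff_subst_killTwo, neg_eq_zero]
    split_ifs with hm1
    · apply coeff_pow_prime_pow_eq_zero p ψ n (i := 0)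
      intro h1
      exact hm (dvd_trans (dvd_pow_self p hn) h1)
    · rfl
  have hG : ∀ s (m : Fin 2 →₀ ℕ), ¬ p ∣ m 0 → coeff m (G s) = 0 := by
    intro s m hm
    rw [hGdef, coeff_subst_killTwo]
    split_ifs with hm1
    · exact coeff_shear_eq_zero_of_dvd_both p h (hD s) hm
    · rfl
  exact eq_zero_of_sum_X_zero_pow_mul hE' hG hrow hs1 hsp

/-! ## Case (c): a `p`-th power is not squarefree -/

/-- CASE (c).  If `A` is concentrated in slot `0`, `A₀(0) = 0`, every exponent of `A₀` is divisible by `p`, and `d = p^n` with `n ≠ 0`,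
then the monic germ `y^d + A₀ = (y^{p^{n-1}} + A₀^{1/p})^p` is not squarefree (`k` perfect). -/
theorem not_squarefree_monicGerm_of_dvd (p : ℕ) [Fact p.Prime] [CharP k p] [PerfectRing k p] {d n : ℕ} (hn : n ≠ 0)
    (hd : d = p ^ n) (A : Fin d → MvPowerSeries (Fin 2) k) (hA : ∀ i : Fin d, (i : ℕ) ≠ 0 → A i = 0) (hd0 : 0 < d)
    (hc : constantCoeff (A ⟨0, hd0⟩) = 0) (hdvd : ∀ e : Fin 2 →₀ ℕ, coeff e (A ⟨0, hd0⟩) ≠ 0 → p ∣ e 0 ∧ p ∣ e 1) :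
    ¬ Squarefree (NCPoly.monicGerm d A) := by
  have hp : p.Prime := Fact.out
  obtain ⟨G, hG, hG0⟩ := exists_pow_eq_of_dvd p (A ⟨0, hd0⟩) (fun e he i => by
    fin_cases i
    · exact (hdvd e he).1
    · exact (hdvd e he).2)
  haveI : CharP (MvPowerSeries (Fin 3) k) p := (Algebra.charP_iff k (MvPowerSeries (Fin 3) k) p).mp inferInstance
  set Z : MvPowerSeries (Fin 3) k := X (Fin.last 2) ^ p ^ (n - 1) + rename (Fin.succAboveEmb (Fin.last 2)) G with hZ
  have hgerm : NCPoly.monicGerm d A = Z ^ p := by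
    rw [NCPoly.monicGerm, Finset.sum_eq_single ⟨0, hd0⟩, Fin.val_mk, pow_zero, mul_one, ← hG, map_pow, hZ, add_pow_expChar,
      ← pow_mul, ← pow_succ, Nat.sub_add_cancel (Nat.one_le_iff_ne_zero.mpr hn), hd]
    · intro j _ hj
      rw [hA j (fun h0 => hj (Fin.ext h0)), map_zero, zero_mul]
    · intro h0
      exact absurd (Finset.mem_univ _) h0
  have hZunit : ¬ IsUnit Z := by
    rw [MvPowerSeries.isUnit_iff_constantCoeff, hZ, map_add, map_pow, constantCoeff_X, zero_pow (pow_ne_zero _ hp.ne_zero), zero_add,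
      constantCoeff_rename]
    intro hu
    have h1 : constantCoeff G ^ p = 0 := by rw [hG0, hc]
    exact (pow_eq_zero_iff hp.ne_zero).not.mpr hu.ne_zero h1
  intro hsq
  rw [hgerm] at hsq
  refine hZunit (hsq Z ⟨Z ^ (p - 2), ?_⟩)
  rw [← pow_two, ← pow_add, Nat.add_sub_cancel' hp.two_le]

/-! ## The witness -/

/-- **(B1b-insep) THE `h`-INDEPENDENT BRANCH WITNESS FOR A PURELY INSEPARABLE LABEL.**  `k` perfect of characteristic `p`, `d = p^n`
with `n ≠ 0`, `A : Fin d → k⟦u₁,u₂⟧` concentrated in slot `0` with squarefree monic germ `y^d + A₀`.  Then ONE series `D ≠ 0` vanishes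
along every graph branch: for every `u₂`-free `h` such that some re-centring `ψ`, `ψ(0) = 0`, makes the sheared label `A(u₁, u₂ + u₁h)`
`V(y,u₂)`-permissible, `D(u₁, u₁h) = 0`. -/
theorem exists_branchWitness_insep (p : ℕ) [Fact p.Prime] [CharP k p] [PerfectRing k p] {d n : ℕ} (hn : n ≠ 0) (hd : d = p ^ n)
    (A : Fin d → MvPowerSeries (Fin 2) k) (hA : ∀ i : Fin d, (i : ℕ) ≠ 0 → A i = 0) (hsq : Squarefree (NCPoly.monicGerm d A)) :
    ∃ D : MvPowerSeries (Fin 2) k, D ≠ 0 ∧ ∀ h : MvPowerSeries (Fin 2) k, (∀ e : Fin 2 →₀ ℕ, e 1 ≠ 0 → coeff e h = 0) →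
      (∃ ψ : MvPowerSeries (Fin 2) k, constantCoeff ψ = 0 ∧ IsPermissibleTwoT d (shift d (shearT h A) ψ)) →
      subst (![X 0, 0] : Fin 2 → MvPowerSeries (Fin 2) k) (shear h D) = 0 := by
  have hp : p.Prime := Fact.out
  have hd0 : 0 < d := by rw [hd]; exact pow_pos hp.pos n
  -- if `A₀(0) ≠ 0` no `h` qualifies
  by_cases hc : constantCoeff (A ⟨0, hd0⟩) ≠ 0
  · refine ⟨1, one_ne_zero, fun h _ ⟨ψ, hψ, hperm⟩ => ?_⟩
    exact (false_of_constantCoeff_ne_zero hd0 hA hc hψ hperm).elim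
  push Not at hc
  by_cases ha : ∃ e : Fin 2 →₀ ℕ, coeff e (A ⟨0, hd0⟩) ≠ 0 ∧ ¬ p ∣ e 1
  · -- case (a)
    obtain ⟨e, he, hpe⟩ := ha
    obtain ⟨C, hC⟩ := exists_modPart p 1 (A ⟨0, hd0⟩)
    refine ⟨C (e 1 % p), modPart_ne_zero 1 _ C hC he, fun h hh ⟨ψ, _, hperm⟩ => ?_⟩
    have ht1 : 1 ≤ e 1 % p := by
      rw [Nat.one_le_iff_ne_zero]
      intro h0
      exact hpe (Nat.dvd_of_mod_eq_zero h0)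
    subst hd
    refine killTwo_shear_modPart_eq_zero p hn (ψ := ψ) hh C (fun t e' he' => dvd_of_coeff_modPart_ne_zero_self 1 _ C hC he') ?_
      ht1 (Nat.mod_lt _ hp.pos)
    intro m hm
    rw [← eq_sum_X_pow_mul_modPart hp.pos 1 (A ⟨0, hd0⟩) C hC]
    exact coeff_slot_zero_eq_zero hd0 hA hperm hm
  push Not at ha
  by_cases hb : ∃ e : Fin 2 →₀ ℕ, coeff e (A ⟨0, hd0⟩) ≠ 0 ∧ ¬ p ∣ e 0
  · -- case (b)
    obtain ⟨e, he, hpe⟩ := hb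
    obtain ⟨D, hD⟩ := exists_modPart p 0 (A ⟨0, hd0⟩)
    refine ⟨D (e 0 % p), modPart_ne_zero 0 _ D hD he, fun h hh ⟨ψ, _, hperm⟩ => ?_⟩
    have hs1 : 1 ≤ e 0 % p := by
      rw [Nat.one_le_iff_ne_zero]
      intro h0
      exact hpe (Nat.dvd_of_mod_eq_zero h0)
    subst hd
    refine killTwo_shear_modPart_eq_zero' p hn (h := h) (ψ := ψ) D (fun s e' he' => ⟨dvd_of_coeff_modPart_ne_zero_self 0 _ D hD he',
      dvd_of_coeff_modPart_ne_zero 0 1 (by decide) _ D hD ha he'⟩) ?_ hs1 (Nat.mod_lt _ hp.pos)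
    intro m hm
    rw [← eq_sum_X_pow_mul_modPart hp.pos 0 (A ⟨0, hd0⟩) D hD]
    exact coeff_slot_zero_eq_zero hd0 hA hperm hm
  · -- case (c)
    push Not at hb
    exact absurd hsq (not_squarefree_monicGerm_of_dvd p hn hd A hA hd0 hc fun e he => ⟨hb e he, ha e he⟩)

/-- (B1b-insep) for an algebraically closed ground field (the TOT2-LINE setting). -/
theorem exists_branchWitness_insep_of_isAlgClosed (p : ℕ) [Fact p.Prime] [CharP k p] [IsAlgClosed k] {d n : ℕ} (hn : n ≠ 0)
    (hd : d = p ^ n) (A : Fin d → MvPowerSeries (Fin 2) k) (hA : ∀ i : Fin d, (i : ℕ) ≠ 0 → A i = 0)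
    (hsq : Squarefree (NCPoly.monicGerm d A)) :
    ∃ D : MvPowerSeries (Fin 2) k, D ≠ 0 ∧ ∀ h : MvPowerSeries (Fin 2) k, (∀ e : Fin 2 →₀ ℕ, e 1 ≠ 0 → coeff e h = 0) →
      (∃ ψ : MvPowerSeries (Fin 2) k, constantCoeff ψ = 0 ∧ IsPermissibleTwoT d (shift d (shearT h A) ψ)) →
      subst (![X 0, 0] : Fin 2 → MvPowerSeries (Fin 2) k) (shear h D) = 0 :=
  exists_branchWitness_insep p hn hd A hA hsq

/-- **(B1) FOR A PURELY INSEPARABLE LABEL = (B1a) ∘ (B1b-insep): FINITELY MANY GRAPH BRANCHES.**  For `A` as in `exists_branchWitness_insep`,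
the set of `u₂`-free `h` for which some re-centring `ψ`, `ψ(0) = 0`, makes `A(u₁, u₂ + u₁h)` `V(y,u₂)`-permissible is finite
(`TOT2Curve.finite_curveRoots`, p547036). -/
theorem finite_graphBranches_insep (p : ℕ) [Fact p.Prime] [CharP k p] [PerfectRing k p] {d n : ℕ} (hn : n ≠ 0) (hd : d = p ^ n)
    (A : Fin d → MvPowerSeries (Fin 2) k) (hA : ∀ i : Fin d, (i : ℕ) ≠ 0 → A i = 0) (hsq : Squarefree (NCPoly.monicGerm d A)) :
    Set.Finite {h : MvPowerSeries (Fin 2) k | (∀ e : Fin 2 →₀ ℕ, e 1 ≠ 0 → coeff e h = 0) ∧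
      ∃ ψ : MvPowerSeries (Fin 2) k, constantCoeff ψ = 0 ∧ IsPermissibleTwoT d (shift d (shearT h A) ψ)} := by
  obtain ⟨D, hD, hroots⟩ := exists_branchWitness_insep p hn hd A hA hsq
  exact (finite_curveRoots hD).subset fun h hh => ⟨hh.1, hroots h hh.1 hh.2⟩

end TOT2Curve

end Summit.ResolutionOfSingularities.ResolutionOfSingularities.Theorems

end
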